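import Summits.FinalStateConjecture.FinalStateConjecture.Theorems.EIHFluxBalanceInertialRecessionStubRechart3BoostTransport
import Summits.FinalStateConjecture.FinalStateConjecture.Theorems.EIHFluxBalanceInertialRecessionTubes
import Literature.Geometry.Lorentzian.KerrConvergenceProofs

/-!
# Route EIHFluxBalance — `InertialRecession`, re-charting: the LAGGED boosted background
# `(Λ, s • Λe₀)` and the transport of charts, images and truncated deviations to it

Helper file for the crux `stmt-FinalStateConjecture-10166`
(`Summit.FinalStateConjecture.FinalStateConjecture.Theses.EIHFluxBalance.InertialRecession`),
stub `stub_rechart` (the transfer P2 of line `sublinear-is-free-clean-window-charges`), part G2.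

The causal transfer (…RechartTransfer3, Claim A) needs the hole clock of a chart to LAG the lab time on
the balls `{rᵢ ≤ Rb}`; the clock of `clockChart_package` is determined only up to an additive constant.
The lag is put into the MOTION: by stationarity of the Kerr–Schild form
(`Kerr.ksPert_eq_of_spatial_eq`, `Kerr.radius_eq_of_spatial_eq`) the background
`boostedKerrBackground Λ (s • Λe₀) M a` has the same domain, metric and radius as
`boostedKerrBackground Λ 0 M a` and the time `t* − s`:
* `poincareInv_lag`, `mem_boostedKerrExterior_lag_iff`, `lag_time`, `lag_radius`, `boostedKerrBilin_lag`;
* `truncDeviationCk_timeShift` — for two backgrounds with equal domain/metric/radius and times differing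
  by `s`, and pointwise equal charts, `truncDeviationCk B₁ Ψ₁ k R τ = truncDeviationCk B₂ Ψ₂ k R (τ + s)`;
  `truncDeviationCk_lag` — the instance for the lagged background and the boosted chart;
* `image_lagChart_eq_boostChart`, `image_lagChart_eq_rest` — images of time/radius-defined sets under a
  chart `ψ` of the lagged background that agrees pointwise with `boostChart Λ M a Ψ_A` are the images under
  `boostChart` (time shifted by `s`) and under the rest chart `Ψ_A` (pulled back by `Λ⁻¹`, time shifted);
* `isOpenEmbedding_lagChart`, `continuous_lag_time`, `continuous_lag_radius`.
[folklore]
-/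

noncomputable section

set_option linter.dupNamespace false

open Set Filter Topology Function TopologicalSpace Literature.Geometry.Lorentzian
open Summit.FinalStateConjecture.FinalStateConjecture.Theorems.SublinearIsFree.Rechart
open scoped Manifold ContDiff ENNReal

namespace Summit.FinalStateConjecture.FinalStateConjecture.Theorems

/-! ### The lagged background as a time shift of the unlagged one -/

section Lag

variable (Λ : lorentzGroup) (s M a : ℝ)

/-- `Λ⁻¹(y − sΛe₀) = Λ⁻¹y − s e₀`. [folklore] -/
theorem poincareInv_lag (y : E4) :
    poincareInv Λ (s • (Λ : E4 ≃L[ℝ] E4) (E4.basisVector 0)) y =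
      (Λ : E4 ≃L[ℝ] E4).symm y - s • E4.basisVector 0 := by
  rw [poincareInv, map_sub, map_smul, ContinuousLinearEquiv.symm_apply_apply]

/-- A time translate has the same spatial part. [folklore] -/
theorem spatial_sub_smul_basisVector_zero (z : E4) (s : ℝ) :
    E4.spatial (z - s • E4.basisVector 0) = E4.spatial z := by
  rw [map_sub, map_smul, spatial_basisVector_zero, smul_zero, sub_zero]

/-- **Time of the lagged background**: `t*(y) = (Λ⁻¹y)⁰ − s`. [folklore] -/
theorem lag_time (y : E4) :
    (boostedKerrBackground Λ (s • (Λ : E4 ≃L[ℝ] E4) (E4.basisVector 0)) M a).time y =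
      ((Λ : E4 ≃L[ℝ] E4).symm y) 0 - s := by
  show (poincareInv Λ (s • (Λ : E4 ≃L[ℝ] E4) (E4.basisVector 0)) y) 0 = _
  rw [poincareInv_lag]
  simp [E4.basisVector]

/-- **Radius of the lagged background**: `r(y) = r_a(Λ⁻¹y)`. [folklore] -/
theorem lag_radius (y : E4) :
    (boostedKerrBackground Λ (s • (Λ : E4 ≃L[ℝ] E4) (E4.basisVector 0)) M a).radius y =
      Kerr.radius a ((Λ : E4 ≃L[ℝ] E4).symm y) := by
  show Kerr.radius a (poincareInv Λ (s • (Λ : E4 ≃L[ℝ] E4) (E4.basisVector 0)) y) = _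
  rw [poincareInv_lag]
  exact Kerr.radius_eq_of_spatial_eq a (spatial_sub_smul_basisVector_zero _ _)

/-- Time and radius of the unlagged boosted background. [folklore] -/
theorem boosted_time_radius (y : E4) :
    (boostedKerrBackground Λ 0 M a).time y = ((Λ : E4 ≃L[ℝ] E4).symm y) 0 ∧
      (boostedKerrBackground Λ 0 M a).radius y = Kerr.radius a ((Λ : E4 ≃L[ℝ] E4).symm y) := by
  constructor
  · show (poincareInv Λ 0 y) 0 = _; rw [poincareInv, sub_zero]
  · show Kerr.radius a (poincareInv Λ 0 y) = _; rw [poincareInv, sub_zero]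

/-- **The lagged exterior is the boosted exterior.** [folklore] -/
theorem mem_boostedKerrExterior_lag_iff (y : E4) :
    y ∈ boostedKerrExterior Λ (s • (Λ : E4 ≃L[ℝ] E4) (E4.basisVector 0)) M a ↔
      y ∈ boostedKerrExterior Λ 0 M a := by
  rw [mem_boostedKerrExterior, mem_boostedKerrExterior, Kerr.mem_exterior, Kerr.mem_exterior,
    poincareInv_lag, poincareInv, sub_zero,
    Kerr.radius_eq_of_spatial_eq a (spatial_sub_smul_basisVector_zero _ _)]

/-- The two exteriors as open sets coincide. [folklore] -/
theorem boostedKerrExterior_lag_eq :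
    boostedKerrExterior Λ (s • (Λ : E4 ≃L[ℝ] E4) (E4.basisVector 0)) M a = boostedKerrExterior Λ 0 M a :=
  Opens.ext (Set.ext fun y ↦ mem_boostedKerrExterior_lag_iff Λ s M a y)

/-- **The lagged form is the boosted form** (stationarity of Kerr–Schild). [cite: KerrSchild1965, §2] -/
theorem boostedKerrBilin_lag (y : E4) :
    boostedKerrBilin Λ (s • (Λ : E4 ≃L[ℝ] E4) (E4.basisVector 0)) M a y = boostedKerrBilin Λ 0 M a y := by
  have hst : Kerr.bilin M a ((Λ : E4 ≃L[ℝ] E4).symm y - s • E4.basisVector 0) =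
      Kerr.bilin M a ((Λ : E4 ≃L[ℝ] E4).symm y) :=
    sub_left_inj.mp (Kerr.ksPert_eq_of_spatial_eq M a (spatial_sub_smul_basisVector_zero _ _))
  refine ContinuousLinearMap.ext fun v ↦ ContinuousLinearMap.ext fun w ↦ ?_
  rw [boostedKerrBilin_apply, boostedKerrBilin_apply, poincareInv_lag, poincareInv, sub_zero, hst]

/-- Membership of `Λ⁻¹y` in the rest exterior for a point of the lagged exterior. [folklore] -/
theorem symm_mem_rest_of_mem_lag {y : E4}
    (hy : y ∈ boostedKerrExterior Λ (s • (Λ : E4 ≃L[ℝ] E4) (E4.basisVector 0)) M a) :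
    (Λ : E4 ≃L[ℝ] E4).symm y ∈ boostedKerrExterior 1 0 M a :=
  symm_mem_boostedKerrExterior_one Λ M a ((mem_boostedKerrExterior_lag_iff Λ s M a y).1 hy)

/-- Membership of `Λz` in the lagged exterior for a point of the rest exterior. [folklore] -/
theorem apply_mem_lag_of_mem_rest {z : E4} (hz : z ∈ boostedKerrExterior 1 0 M a) :
    (Λ : E4 ≃L[ℝ] E4) z ∈ boostedKerrExterior Λ (s • (Λ : E4 ≃L[ℝ] E4) (E4.basisVector 0)) M a := by
  rw [mem_boostedKerrExterior_lag_iff]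
  refine mem_boostedKerrExterior_of_symm Λ M a ?_
  rwa [ContinuousLinearEquiv.symm_apply_apply]

/-- The time and radius functions of the lagged background are continuous. [folklore] -/
theorem continuous_lag_time_radius :
    Continuous (boostedKerrBackground Λ (s • (Λ : E4 ≃L[ℝ] E4) (E4.basisVector 0)) M a).time ∧
      Continuous (boostedKerrBackground Λ (s • (Λ : E4 ≃L[ℝ] E4) (E4.basisVector 0)) M a).radius := by
  have hc := continuous_poincareInv Λ (s • (Λ : E4 ≃L[ℝ] E4) (E4.basisVector 0))
  exact ⟨(EuclideanSpace.proj (0 : Fin 4) : E4 →L[ℝ] ℝ).continuous.comp hc,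
    (Kerr.continuous_radius a).comp hc⟩

end Lag

/-! ### Time-shift transport of the truncated deviation -/

/-- **Time-shift transport.** Two backgrounds with the same domain, form and radius whose time functions
differ by the constant `s`, and two charts that agree pointwise, have
`truncDeviationCk B₁ Ψ₁ k R τ = truncDeviationCk B₂ Ψ₂ k R (τ + s)`. [folklore] -/
theorem truncDeviationCk_timeShift {𝓢 : Spacetime 4} {B₁ B₂ : ModelBackground} {s : ℝ}
    (hd : B₁.domain = B₂.domain) (hb : B₁.bilin = B₂.bilin) (hr : B₁.radius = B₂.radius)
    (ht : ∀ x, B₁.time x = B₂.time x - s) (Ψ₁ : B₁.domain → 𝓢.carrier) (Ψ₂ : B₂.domain → 𝓢.carrier)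
    (hΨ : ∀ (x : E4) (h₁ : x ∈ B₁.domain) (h₂ : x ∈ B₂.domain), Ψ₁ ⟨x, h₁⟩ = Ψ₂ ⟨x, h₂⟩)
    (k : ℕ) (R τ : ℝ) :
    𝓢.truncDeviationCk B₁ Ψ₁ k R τ = 𝓢.truncDeviationCk B₂ Ψ₂ k R (τ + s) := by
  obtain ⟨d₁, b₁, t₁, r₁⟩ := B₁
  obtain ⟨d₂, b₂, t₂, r₂⟩ := B₂
  simp only at hd hb hr ht hΨ
  subst hd hb hr
  have ht' : t₁ = fun x ↦ t₂ x - s := funext ht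
  subst ht'
  have hΨ' : Ψ₁ = Ψ₂ := funext fun x ↦ hΨ x.1 x.2 x.2
  subst hΨ'
  unfold Spacetime.truncDeviationCk
  have hset : Subtype.val '' (⟨d₁, b₁, fun x ↦ t₂ x - s, r₁⟩ : ModelBackground).truncTimeSlab R τ =
      Subtype.val '' (⟨d₁, b₁, t₂, r₁⟩ : ModelBackground).truncTimeSlab R (τ + s) := by
    refine congrArg (Set.image Subtype.val) (Set.ext fun x ↦ ?_)
    rw [ModelBackground.mem_truncTimeSlab, ModelBackground.mem_truncTimeSlab]
    show t₂ x.1 - s = τ ∧ r₁ x.1 ≤ R ↔ t₂ x.1 = τ + s ∧ r₁ x.1 ≤ R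
    rw [sub_eq_iff_eq_add]
  rw [hset]
  rfl

section Charts

variable {𝓢 : Spacetime 4} (Λ : lorentzGroup) (s M a : ℝ)
  (Ψ_A : boostedKerrExterior 1 0 M a → 𝓢.carrier)
  (ψ : boostedKerrExterior Λ (s • (Λ : E4 ≃L[ℝ] E4) (E4.basisVector 0)) M a → 𝓢.carrier)
  (hψ : ∀ y, ψ y = Ψ_A ⟨(Λ : E4 ≃L[ℝ] E4).symm y.1, symm_mem_rest_of_mem_lag Λ s M a y.2⟩)

include hψ in
/-- **Truncated deviation of the lagged chart** = that of the boosted chart at the shifted time. [folklore] -/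
theorem truncDeviationCk_lag (k : ℕ) (R τ : ℝ) :
    𝓢.truncDeviationCk (boostedKerrBackground Λ (s • (Λ : E4 ≃L[ℝ] E4) (E4.basisVector 0)) M a) ψ k R τ =
      𝓢.truncDeviationCk (boostedKerrBackground Λ 0 M a) (boostChart Λ M a Ψ_A) k R (τ + s) := by
  have hd : (boostedKerrBackground Λ (s • (Λ : E4 ≃L[ℝ] E4) (E4.basisVector 0)) M a).domain =
      (boostedKerrBackground Λ 0 M a).domain := boostedKerrExterior_lag_eq Λ s M a
  have hb : (boostedKerrBackground Λ (s • (Λ : E4 ≃L[ℝ] E4) (E4.basisVector 0)) M a).bilin =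
      (boostedKerrBackground Λ 0 M a).bilin := funext fun y ↦ boostedKerrBilin_lag Λ s M a y
  have hr : (boostedKerrBackground Λ (s • (Λ : E4 ≃L[ℝ] E4) (E4.basisVector 0)) M a).radius =
      (boostedKerrBackground Λ 0 M a).radius :=
    funext fun y ↦ (lag_radius Λ s M a y).trans (boosted_time_radius Λ M a y).2.symm
  have ht : ∀ y, (boostedKerrBackground Λ (s • (Λ : E4 ≃L[ℝ] E4) (E4.basisVector 0)) M a).time y =
      (boostedKerrBackground Λ 0 M a).time y - s := fun y ↦ by
    rw [lag_time, (boosted_time_radius Λ M a y).1]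
  exact truncDeviationCk_timeShift (B₁ := boostedKerrBackground Λ (s • (Λ : E4 ≃L[ℝ] E4) (E4.basisVector 0)) M a)
    (B₂ := boostedKerrBackground Λ 0 M a) hd hb hr ht ψ (boostChart Λ M a Ψ_A)
    (fun x h₁ _ ↦ (hψ ⟨x, h₁⟩).trans rfl) k R τ

include hψ in
/-- **Transport of the truncated deviation to the lagged chart** (with the boost constant of
`truncDeviationCk_boostTransport_le`). [folklore] -/
theorem truncDeviationCk_lag_le (hΨ : ContMDiff 𝓘(ℝ, E4) (𝓡 4) ∞ Ψ_A) (k : ℕ) (R τ : ℝ) :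
    𝓢.truncDeviationCk (boostedKerrBackground Λ (s • (Λ : E4 ≃L[ℝ] E4) (E4.basisVector 0)) M a) ψ k R τ ≤
      ENNReal.ofReal (max 1 ‖(((Λ : E4 ≃L[ℝ] E4).symm : E4 →L[ℝ] E4))‖ ^ (k + 2)) *
        𝓢.truncDeviationCk (boostedKerrBackground 1 0 M a) Ψ_A k R (τ + s) := by
  rw [truncDeviationCk_lag Λ s M a Ψ_A ψ hψ]
  exact truncDeviationCk_boostTransport_le Λ M a Ψ_A hΨ k R (τ + s)

include hψ in
/-- **Near-zone convergence on a profile transfers to the lagged chart**: if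
`truncDeviationCk (rest) Ψ_A k (R τ) τ → 0` then `truncDeviationCk (lagged) ψ k (R (τ + s)) τ → 0`. [folklore] -/
theorem tendsto_truncDeviationCk_lag (hΨ : ContMDiff 𝓘(ℝ, E4) (𝓡 4) ∞ Ψ_A) (k : ℕ) (R : ℝ → ℝ)
    (h : Tendsto (fun τ ↦ 𝓢.truncDeviationCk (boostedKerrBackground 1 0 M a) Ψ_A k (R τ) τ) atTop (𝓝 0)) :
    Tendsto (fun τ ↦ 𝓢.truncDeviationCk
      (boostedKerrBackground Λ (s • (Λ : E4 ≃L[ℝ] E4) (E4.basisVector 0)) M a) ψ k (R (τ + s)) τ)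
      atTop (𝓝 0) := by
  set c : ℝ≥0∞ := ENNReal.ofReal (max 1 ‖(((Λ : E4 ≃L[ℝ] E4).symm : E4 →L[ℝ] E4))‖ ^ (k + 2)) with hc
  have h' : Tendsto (fun τ ↦ 𝓢.truncDeviationCk (boostedKerrBackground 1 0 M a) Ψ_A k (R (τ + s)) (τ + s))
      atTop (𝓝 0) := h.comp (tendsto_atTop_add_const_right atTop s tendsto_id)
  have hlim : Tendsto (fun τ ↦ c * 𝓢.truncDeviationCk (boostedKerrBackground 1 0 M a) Ψ_A k (R (τ + s)) (τ + s))
      atTop (𝓝 0) := by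
    have := ENNReal.Tendsto.const_mul (a := c) h' (Or.inr (by rw [hc]; exact ENNReal.ofReal_ne_top))
    rwa [mul_zero] at this
  exact tendsto_of_tendsto_of_tendsto_of_le_of_le tendsto_const_nhds hlim (fun _ ↦ bot_le)
    fun τ ↦ truncDeviationCk_lag_le Λ s M a Ψ_A ψ hψ hΨ k (R (τ + s)) τ

include hψ in
/-- **Images of time/radius sets under the lagged chart = images under the rest chart** (model point
`z = Λ⁻¹y`, time `z⁰ − s`, radius `r_a(z)`). [folklore] -/
theorem image_lagChart_eq_rest (P : ℝ → ℝ → Prop) :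
    ψ '' {y | P ((boostedKerrBackground Λ (s • (Λ : E4 ≃L[ℝ] E4) (E4.basisVector 0)) M a).time y.1)
        ((boostedKerrBackground Λ (s • (Λ : E4 ≃L[ℝ] E4) (E4.basisVector 0)) M a).radius y.1)} =
      Ψ_A '' {z | P (z.1 0 - s) (Kerr.radius a z.1)} := by
  ext p
  constructor
  · rintro ⟨y, hy, rfl⟩
    rw [mem_setOf_eq, lag_time, lag_radius] at hy
    exact ⟨⟨(Λ : E4 ≃L[ℝ] E4).symm y.1, symm_mem_rest_of_mem_lag Λ s M a y.2⟩, hy, (hψ y).symm⟩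
  · rintro ⟨z, hz, rfl⟩
    refine ⟨⟨(Λ : E4 ≃L[ℝ] E4) z.1, apply_mem_lag_of_mem_rest Λ s M a z.2⟩, ?_, ?_⟩
    · rw [mem_setOf_eq, lag_time, lag_radius, ContinuousLinearEquiv.symm_apply_apply]; exact hz
    · rw [hψ]
      congr 1
      exact Subtype.ext ((Λ : E4 ≃L[ℝ] E4).symm_apply_apply z.1)

include hψ in
/-- **Images under the lagged chart = images under the boosted chart at shifted time.** [folklore] -/
theorem image_lagChart_eq_boostChart (P : ℝ → ℝ → Prop) :
    ψ '' {y | P ((boostedKerrBackground Λ (s • (Λ : E4 ≃L[ℝ] E4) (E4.basisVector 0)) M a).time y.1)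
        ((boostedKerrBackground Λ (s • (Λ : E4 ≃L[ℝ] E4) (E4.basisVector 0)) M a).radius y.1)} =
      boostChart Λ M a Ψ_A '' {y | P ((boostedKerrBackground Λ 0 M a).time y.1 - s)
        ((boostedKerrBackground Λ 0 M a).radius y.1)} := by
  ext p
  constructor
  · rintro ⟨y, hy, rfl⟩
    rw [mem_setOf_eq, lag_time, lag_radius] at hy
    refine ⟨⟨y.1, (mem_boostedKerrExterior_lag_iff Λ s M a y.1).1 y.2⟩, ?_, ?_⟩
    · rw [mem_setOf_eq, (boosted_time_radius Λ M a y.1).1, (boosted_time_radius Λ M a y.1).2]; exact hy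
    · rw [hψ]; rfl
  · rintro ⟨y, hy, rfl⟩
    rw [mem_setOf_eq, (boosted_time_radius Λ M a y.1).1, (boosted_time_radius Λ M a y.1).2] at hy
    refine ⟨⟨y.1, (mem_boostedKerrExterior_lag_iff Λ s M a y.1).2 y.2⟩, ?_, ?_⟩
    · rw [mem_setOf_eq, lag_time, lag_radius]; exact hy
    · rw [hψ]; rfl

include hψ in
/-- The four standard instances: truncated slabs, truncated late regions, late regions and certified
sets of the lagged chart are the corresponding rest-chart images at shifted times. [folklore] -/
theorem image_lagChart_slabs (R τ τ₁ : ℝ) (Rp : ℝ → ℝ) :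
    ψ '' (boostedKerrBackground Λ (s • (Λ : E4 ≃L[ℝ] E4) (E4.basisVector 0)) M a).truncTimeSlab R τ =
        Ψ_A '' (boostedKerrBackground 1 0 M a).truncTimeSlab R (τ + s) ∧
      ψ '' (boostedKerrBackground Λ (s • (Λ : E4 ≃L[ℝ] E4) (E4.basisVector 0)) M a).truncLateRegion τ₁ R =
        Ψ_A '' (boostedKerrBackground 1 0 M a).truncLateRegion (τ₁ + s) R ∧
      ψ '' (boostedKerrBackground Λ (s • (Λ : E4 ≃L[ℝ] E4) (E4.basisVector 0)) M a).lateRegion τ₁ =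
        Ψ_A '' (boostedKerrBackground 1 0 M a).lateRegion (τ₁ + s) ∧
      ψ '' {y | τ₁ < (boostedKerrBackground Λ (s • (Λ : E4 ≃L[ℝ] E4) (E4.basisVector 0)) M a).time y.1 ∧
          (boostedKerrBackground Λ (s • (Λ : E4 ≃L[ℝ] E4) (E4.basisVector 0)) M a).radius y.1 ≤
            Rp ((boostedKerrBackground Λ (s • (Λ : E4 ≃L[ℝ] E4) (E4.basisVector 0)) M a).time y.1)} =
        Ψ_A '' {z | τ₁ + s < (boostedKerrBackground 1 0 M a).time z.1 ∧
          (boostedKerrBackground 1 0 M a).radius z.1 ≤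
            Rp ((boostedKerrBackground 1 0 M a).time z.1 - s)} := by
  have hrest : ∀ z : E4, (boostedKerrBackground 1 0 M a).time z = z 0 ∧
      (boostedKerrBackground 1 0 M a).radius z = Kerr.radius a z := fun z ↦ by
    constructor
    · show (poincareInv 1 0 z) 0 = z 0; rw [Literature.Geometry.Lorentzian.poincareInv_one_zero]
    · show Kerr.radius a (poincareInv 1 0 z) = _; rw [Literature.Geometry.Lorentzian.poincareInv_one_zero]
  refine ⟨?_, ?_, ?_, ?_⟩
  · have h := image_lagChart_eq_rest Λ s M a Ψ_A ψ hψ (fun t r ↦ t = τ ∧ r ≤ R)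
    refine Eq.trans rfl (h.trans (congrArg (Set.image Ψ_A) (Set.ext fun z ↦ ?_)))
    change z.1 0 - s = τ ∧ Kerr.radius a z.1 ≤ R ↔
      (boostedKerrBackground 1 0 M a).time z.1 = τ + s ∧ (boostedKerrBackground 1 0 M a).radius z.1 ≤ R
    rw [(hrest z.1).1, (hrest z.1).2, sub_eq_iff_eq_add]
  · have h := image_lagChart_eq_rest Λ s M a Ψ_A ψ hψ (fun t r ↦ τ₁ < t ∧ r ≤ R)
    refine Eq.trans rfl (h.trans (congrArg (Set.image Ψ_A) (Set.ext fun z ↦ ?_)))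
    change τ₁ < z.1 0 - s ∧ Kerr.radius a z.1 ≤ R ↔
      τ₁ + s < (boostedKerrBackground 1 0 M a).time z.1 ∧ (boostedKerrBackground 1 0 M a).radius z.1 ≤ R
    rw [(hrest z.1).1, (hrest z.1).2, lt_sub_iff_add_lt]
  · have h := image_lagChart_eq_rest Λ s M a Ψ_A ψ hψ (fun t _ ↦ τ₁ < t)
    refine Eq.trans rfl (h.trans (congrArg (Set.image Ψ_A) (Set.ext fun z ↦ ?_)))
    change τ₁ < z.1 0 - s ↔ τ₁ + s < (boostedKerrBackground 1 0 M a).time z.1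
    rw [(hrest z.1).1, lt_sub_iff_add_lt]
  · have h := image_lagChart_eq_rest Λ s M a Ψ_A ψ hψ (fun t r ↦ τ₁ < t ∧ r ≤ Rp t)
    refine h.trans (congrArg (Set.image Ψ_A) (Set.ext fun z ↦ ?_))
    change τ₁ < z.1 0 - s ∧ Kerr.radius a z.1 ≤ Rp (z.1 0 - s) ↔
      τ₁ + s < (boostedKerrBackground 1 0 M a).time z.1 ∧
        (boostedKerrBackground 1 0 M a).radius z.1 ≤ Rp ((boostedKerrBackground 1 0 M a).time z.1 - s)
    rw [(hrest z.1).1, (hrest z.1).2, lt_sub_iff_add_lt]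

/-- **The lagged chart is an open embedding** when the rest chart is. [folklore] -/
theorem isOpenEmbedding_lagChart (hemb : IsOpenEmbedding Ψ_A)
    (hψ : ∀ y, ψ y = Ψ_A ⟨(Λ : E4 ≃L[ℝ] E4).symm y.1, symm_mem_rest_of_mem_lag Λ s M a y.2⟩) :
    IsOpenEmbedding ψ := by
  -- the coordinate change is a homeomorphism between the two domains
  set e : boostedKerrExterior Λ (s • (Λ : E4 ≃L[ℝ] E4) (E4.basisVector 0)) M a ≃ₜ
      boostedKerrExterior 1 0 M a :=
    { toFun := fun y ↦ ⟨(Λ : E4 ≃L[ℝ] E4).symm y.1, symm_mem_rest_of_mem_lag Λ s M a y.2⟩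
      invFun := fun z ↦ ⟨(Λ : E4 ≃L[ℝ] E4) z.1, apply_mem_lag_of_mem_rest Λ s M a z.2⟩
      left_inv := fun y ↦ Subtype.ext ((Λ : E4 ≃L[ℝ] E4).apply_symm_apply y.1)
      right_inv := fun z ↦ Subtype.ext ((Λ : E4 ≃L[ℝ] E4).symm_apply_apply z.1)
      continuous_toFun := ((Λ : E4 ≃L[ℝ] E4).symm.continuous.comp continuous_subtype_val).subtype_mk _
      continuous_invFun := ((Λ : E4 ≃L[ℝ] E4).continuous.comp continuous_subtype_val).subtype_mk _ }
    with he
  have hcomp : ψ = Ψ_A ∘ e := funext fun y ↦ hψ y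
  rw [hcomp]
  exact hemb.comp e.isOpenEmbedding

end Charts

/-- Registered one-line form (stub `spatial_sub_smul_basisVector_zero_rechart` of the crux item) of
`spatial_sub_smul_basisVector_zero`. [folklore] -/
theorem spatial_sub_smul_basisVector_zero_rechart : open Literature.Geometry.Lorentzian in ∀ (z : E4) (s : ℝ), E4.spatial (z - s • E4.basisVector 0) = E4.spatial z :=
  spatial_sub_smul_basisVector_zero

end Summit.FinalStateConjecture.FinalStateConjecture.Theorems
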